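import Literature.Probability.RandomPlanarGeometry.SAWWords
import HarnessLib

/-!
# A certified upper bound on the adsorption transition of the planar self-avoiding walk:
# `Z⁺_n(53/25) ≥ K · (269/100)^n`, i.e. `a_c(ℤ², impenetrable wall, vertex weights) ≤ 2.12` given `μ(ℤ²) < 2.69`

Topic `Literature/Probability/RandomPlanarGeometry` (continues `SAWWords.lean` — step words `List Step` on `ℤ²`,
`traj`, `words n`, `traj_injOn`, `isSAW_iff_injOn`, `traj_mem_saws`).

## The objects (as printed) and the statement

Hammersley–Torrie–Whittington (1982) / Beaton–Guttmann–Jensen (2012, J. Phys. A 45 055208, p. 2): self-avoiding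
walks in the upper half-plane `x₀ ≥ 0` from the origin on the wall `x₀ = 0`, weighted by `a^{#visits to the wall}`
(vertex weights, times `1, …, n`): `Z⁺_n(a) = Σ_ω a^{v(ω)}`; the adsorption free energy `κ(a) = lim n⁻¹ log Z⁺_n(a)`
satisfies `κ(a) = log μ` for `a ≤ a_c` and `κ(a) > log μ` for `a > a_c`; in print `1 < a_c ≤ μ ≈ 2.64` (BGJ 2012
p. 2; numerically `a_c = 1.77564`). This file proves the FINITE statement (a-idea-1's `AdsorbedAbove`, body
verbatim)

  `AdsorbedAbove (53/25) (269/100)`:  `∃ K > 0, ∀ n, K · (269/100)^n ≤ Z⁺_n(53/25)`,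

i.e. `κ(2.12) ≥ log 2.69`; since `2.69 > 2.688 ≥ μ(ℤ²)` (the tree's certified upper bound, `SAWFiniteMemory18`),
this reads `a_c ≤ 2.12` for the HTW adsorption point `a_c = sup {a : κ(a) = log μ}`.

## The mechanism: a partially directed wall-returning family and a Perron sub-eigenvector

A sub-family of half-plane walks generated by a 13-state step automaton (`HookState`, `HookState.step`): wall steps `R`
(east along the wall) and HOOKS — climb `h₀ ≤ 4` in the current column, then alternately one step east and a
monotone vertical move to a new height `≤ 4`, finally descend to the wall; then east along the wall again. Every
accepted word is a self-avoiding half-plane walk (`traj_mem_hpWalks_of_accepted`: in the current column the visited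
sites lie strictly below a climbing walker / strictly above a descending one, and nothing lies to the east), the
wall visits are the automaton's wall landings (`wallVisits_traj_eq_landings`), and the `a`-weighted number of
accepted words `hookCount` satisfies a linear recursion whose transition matrix `M(a)` at `a = 53/25` admits
the explicit rational vector `u` with `M u ≥ (269/100) u` componentwise (`hook_certificate`, 13 inequalities by
`norm_num`). Hence `Z⁺_n(53/25) ≥ N_n(W) ≥ u_W (269/100)^n` (`adsorbedAbove_212`). The family's own growth rate at
`a = 2.12` is `2.69348…`; the full partially directed family would certify `a_c ≤ 2.1151` at `Λ = 2.69`.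
(Lane «pcv-sawmu» route R63 v2, a-idea-1 typed; this kernel edition replaces the `4 × 4` resolvent certificate by
a sub-eigenvector.)
-/

noncomputable section

open Finset
open Literature.Probability.LatticeModels Literature.Probability.Percolation SimpleGraph

namespace Literature.Probability.RandomPlanarGeometry.SAW.Zd

/-! ### Half-plane walks, wall visits, the adsorption partition function -/

open Classical in
/-- `n`-step self-avoiding walks from the origin in the upper half-plane `x₀ ≥ 0` (the wall is the line `x₀ = 0`).
(a-idea-1's `hpWalks`, body verbatim.) [cite: BeatonGuttmannJensen2012Adsorption, §1 (p. 2)] -/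
def hpWalks (n : ℕ) : Finset (ℕ → Site 2) := (saws 2 n).filter fun ω => ∀ i ≤ n, 0 ≤ ω i 0

open Classical in
/-- Visits to the wall at times `k ∈ [1,n]` (vertex weights, Hammersley–Torrie–Whittington convention).
(a-idea-1's `wallVisits`, body verbatim.) [cite: BeatonGuttmannJensen2012Adsorption, §1 (p. 2)] -/
def wallVisits (n : ℕ) (ω : ℕ → Site 2) : ℕ := ((range (n + 1)).filter fun k => 1 ≤ k ∧ ω k 0 = 0).card

/-- `Z⁺_n(a) = Σ_{ω ∈ hpWalks n} a^{wallVisits}`. (a-idea-1's `adsZ`, body verbatim.)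
[cite: BeatonGuttmannJensen2012Adsorption, §1 (p. 2)] -/
def adsZ (n : ℕ) (a : ℝ) : ℝ := ∑ ω ∈ hpWalks n, a ^ wallVisits n ω

/-- «the adsorbed free energy at fugacity `a` is at least `log Λ`», finite form: `∃ K > 0, ∀ n, K Λⁿ ≤ Z⁺_n(a)`.
With `Λ > μ(ℤ²)` this says `a > a_c` for the HTW adsorption point. (a-idea-1's `AdsorbedAbove`, body verbatim.)
[cite: BeatonGuttmannJensen2012Adsorption, §1 (p. 2)] -/
def AdsorbedAbove (a Λ : ℝ) : Prop := ∃ K : ℝ, 0 < K ∧ ∀ n : ℕ, K * Λ ^ n ≤ adsZ n a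

/-! ### The hook automaton -/

/-- States of the hook automaton: `W` on the wall at a piece boundary; `E` on the wall at the foot of a hook (must
step east next); `U k` climbing at height `k+1`; `A k` just arrived at height `k+1` by an east step; `D k` descending
at height `k+1`; `X` dead. [cite: BeatonGuttmannJensen2012Adsorption, §1 (p. 2)] -/
inductive HookState
  | W : HookState
  | E : HookState
  | U : ℕ → HookState
  | A : ℕ → HookState
  | D : ℕ → HookState
  | X : HookState
  deriving DecidableEq

namespace HookState

/-- Height (`x₀`-coordinate) of a state; `X` gets a junk nonzero height. [cite: BeatonGuttmannJensen2012Adsorption, §1 (p. 2)] -/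
def hgt : HookState → ℕ
  | W => 0
  | E => 0
  | U k => k + 1
  | A k => k + 1
  | D k => k + 1
  | X => 37

/-- One step of the automaton (`Step`: `0 = +e₀` up/away from the wall, `1 = +e₁` east, `2 = −e₀` down,
`3 = −e₁` never). Heights are capped at `4`. [cite: BeatonGuttmannJensen2012Adsorption, §1 (p. 2)] -/
def step : HookState → Step → HookState
  | W, s => if s = 0 then U 0 else if s = 1 then W else X
  | E, s => if s = 1 then W else X
  | U k, s => if s = 0 then (if k < 3 then U (k + 1) else X) else if s = 1 then A k else X
  | A k, s => if s = 0 then (if k < 3 then U (k + 1) else X)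
      else if s = 1 then A k else if s = 2 then (if k = 0 then E else D (k - 1)) else X
  | D k, s => if s = 1 then A k else if s = 2 then (if k = 0 then E else D (k - 1)) else X
  | X, _ => X

/-- Run the automaton along a word. [cite: BeatonGuttmannJensen2012Adsorption, §1 (p. 2)] -/
def run (s : HookState) : List Step → HookState
  | [] => s
  | st :: w => run (step s st) w

/-- A landing on the wall: the target state is `W` or `E`. [cite: BeatonGuttmannJensen2012Adsorption, §1 (p. 2)] -/
def isWall (s : HookState) : Prop := s = W ∨ s = E

/-- `isWall` is decidable. [folklore] -/
instance (s : HookState) : Decidable (isWall s) := inferInstanceAs (Decidable (s = W ∨ s = E))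

/-- Number of wall landings along a word. [cite: BeatonGuttmannJensen2012Adsorption, §1 (p. 2)] -/
def landings (s : HookState) : List Step → ℕ
  | [] => 0
  | st :: w => (if isWall (step s st) then 1 else 0) + landings (step s st) w

/-- The dead state is absorbing. [folklore] -/
@[simp] private theorem step_X (st : Step) : step X st = X := rfl

/-- Running from the dead state stays dead. [folklore] -/
private theorem run_X : ∀ w : List Step, run X w = X
  | [] => rfl
  | _ :: w => by rw [run, step_X]; exact run_X w

/-- `run` along a concatenation. [folklore] -/
private theorem run_append (s : HookState) : ∀ w w' : List Step, run s (w ++ w') = run (run s w) w'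
  | [], _ => rfl
  | st :: w, w' => by rw [List.cons_append, run, run, run_append]

/-- If a word is accepted then so is every prefix state. [folklore] -/
private theorem run_ne_X_of_append {s : HookState} {w w' : List Step} (h : run s (w ++ w') ≠ X) : run s w ≠ X := by
  intro hX
  rw [run_append, hX, run_X] at h
  exact h rfl

/-- `isWall s ↔ hgt s = 0`. [folklore] -/
private theorem isWall_iff_hgt (s : HookState) : isWall s ↔ hgt s = 0 := by
  cases s <;> simp [isWall, hgt]

/-! ### Transition facts used by the geometric invariant -/

/-- Column relation of a state: what is known about the EARLIER sites of the current column (heights `y`). [cite: BeatonGuttmannJensen2012Adsorption, §1 (p. 2)] -/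
def rel : HookState → ℤ → Prop
  | W => fun y => y < 0
  | E => fun y => 0 < y
  | U k => fun y => y < (k : ℤ) + 1
  | A _ => fun _ => False
  | D k => fun y => (k : ℤ) + 1 < y
  | X => fun _ => True

/-- The backward step `−e₁` is never allowed. [folklore] -/
private theorem step_three (s : HookState) : step s 3 = X := by
  cases s <;> simp [step]

/-- An east step keeps the height. [folklore] -/
private theorem hgt_step_one {s : HookState} (h : step s 1 ≠ X) : hgt (step s 1) = hgt s := by
  cases s <;> simp_all [step, hgt]

/-- An up step: the height increases by one, all earlier sites of the column lie strictly below the old height,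
and the new state records «strictly below the new height». [folklore] -/
private theorem step_zero_spec {s : HookState} (h : step s 0 ≠ X) :
    hgt (step s 0) = hgt s + 1 ∧ (∀ y, rel s y → y < hgt s) ∧ (∀ y, y < (hgt s : ℤ) + 1 → rel (step s 0) y) := by
  cases s with
  | W => refine ⟨by simp [step, hgt], fun y hy => ?_, fun y hy => ?_⟩ <;> simp_all [step, hgt, rel]
  | E => simp [step] at h
  | U k =>
    by_cases hk : k < 3
    · refine ⟨by simp [step, hgt, hk], fun y hy => ?_, fun y hy => ?_⟩ <;> simp_all [step, hgt, rel]
    · simp [step, hk] at h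
  | A k =>
    by_cases hk : k < 3
    · refine ⟨by simp [step, hgt, hk], fun y hy => ?_, fun y hy => ?_⟩ <;> simp_all [step, hgt, rel]
    · simp [step, hk] at h
  | D k => simp [step] at h
  | X => simp [step] at h

/-- A down step: the height decreases by one, all earlier sites of the column lie strictly above the old height,
and the new state records «strictly above the new height». [folklore] -/
private theorem step_two_spec {s : HookState} (h : step s 2 ≠ X) :
    hgt (step s 2) + 1 = hgt s ∧ (∀ y, rel s y → (hgt s : ℤ) < y) ∧ (∀ y, (hgt (step s 2) : ℤ) < y → rel (step s 2) y) := by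
  cases s with
  | W => simp [step] at h
  | E => simp [step] at h
  | U k => simp [step] at h
  | A k =>
    by_cases hk : k = 0
    · subst hk; refine ⟨by simp [step, hgt], fun y hy => ?_, fun y hy => ?_⟩ <;> simp_all [step, hgt, rel]
    · refine ⟨by simp [step, hgt, hk]; omega, fun y hy => ?_, fun y hy => ?_⟩ <;> simp_all [step, hgt, rel]
  | D k =>
    by_cases hk : k = 0
    · subst hk; refine ⟨by simp [step, hgt], fun y hy => ?_, fun y hy => ?_⟩ <;> simp_all [step, hgt, rel]
    · refine ⟨by simp [step, hgt, hk]; omega, fun y hy => ?_, fun y hy => ?_⟩ <;> simp_all [step, hgt, rel]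
  | X => simp [step] at h

end HookState

open HookState

/-! ### Accepted words are half-plane self-avoiding walks -/

/-- The state after `i` steps of `w`, started at `W`. [cite: BeatonGuttmannJensen2012Adsorption, §1 (p. 2)] -/
def stateAt (w : List Step) (i : ℕ) : HookState := run W (w.take i)

/-- Initial state. [folklore] -/
private theorem stateAt_zero (w : List Step) : stateAt w 0 = W := rfl

/-- One more step. [folklore] -/
private theorem stateAt_succ (w : List Step) {i : ℕ} (hi : i < w.length) :
    stateAt w (i + 1) = step (stateAt w i) (w[i]) := by
  rw [stateAt, stateAt, List.take_succ_eq_append_getElem hi, run_append]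
  rfl

/-- Prefix states of an accepted word are live. [folklore] -/
private theorem stateAt_ne_X {w : List Step} (hacc : run W w ≠ X) (i : ℕ) : stateAt w i ≠ X := by
  have : w = w.take i ++ w.drop i := (List.take_append_drop i w).symm
  rw [this] at hacc
  exact run_ne_X_of_append hacc

/-- The step coordinates. [folklore] -/
private theorem dx_dy_of_step (st : Step) :
    (st = 0 ∧ Step.dx st = 1 ∧ Step.dy st = 0) ∨ (st = 1 ∧ Step.dx st = 0 ∧ Step.dy st = 1) ∨
      (st = 2 ∧ Step.dx st = -1 ∧ Step.dy st = 0) ∨ (st = 3 ∧ Step.dx st = 0 ∧ Step.dy st = -1) := by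
  fin_cases st <;> simp [Step.dx, Step.dy]

/-- **The geometric invariant** of an accepted word after `i` steps: the walker's height is the state's height,
all heights are `≥ 0`, no earlier site lies to the east, and the earlier sites of the current column satisfy the
state's column relation. [folklore] -/
private theorem hook_invariant {w : List Step} (hacc : run W w ≠ X) :
    ∀ i, i ≤ w.length →
      (traj w i 0 = hgt (stateAt w i)) ∧ (∀ i', i' ≤ i → 0 ≤ traj w i' 0) ∧
        (∀ i', i' < i → traj w i' 1 ≤ traj w i 1) ∧
        (∀ i', i' < i → traj w i' 1 = traj w i 1 → rel (stateAt w i) (traj w i' 0)) := by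
  intro i
  induction i with
  | zero =>
    intro _
    refine ⟨by simp [stateAt_zero, hgt], fun i' hi' => ?_, fun i' hi' => absurd hi' (by omega),
      fun i' hi' => absurd hi' (by omega)⟩
    have : i' = 0 := by omega
    subst this; simp
  | succ i ih =>
    intro hi
    obtain ⟨hA, hB, hC, hD⟩ := ih (by omega)
    have hlt : i < w.length := by omega
    have hs := stateAt_succ w hlt
    have hX : step (stateAt w i) (w[i]) ≠ X := by rw [← hs]; exact stateAt_ne_X hacc (i + 1)
    have ht := traj_succ w hlt
    have hx : traj w (i + 1) 0 = traj w i 0 + Step.dx (w[i]) := by rw [ht]; simp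
    have hy : traj w (i + 1) 1 = traj w i 1 + Step.dy (w[i]) := by rw [ht]; simp
    rcases dx_dy_of_step (w[i]) with ⟨h0, hdx, hdy⟩ | ⟨h1, hdx, hdy⟩ | ⟨h2, hdx, hdy⟩ | ⟨h3, hdx, hdy⟩
    · -- up
      rw [h0] at hX hs
      obtain ⟨hh, hold, hnew⟩ := step_zero_spec hX
      rw [hdx] at hx; rw [hdy] at hy
      refine ⟨?_, ?_, ?_, ?_⟩
      · rw [hs, hh, hx, hA]; push_cast; ring
      · intro i' hi'
        rcases Nat.lt_or_ge i' (i + 1) with h | h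
        · exact hB i' (by omega)
        · have : i' = i + 1 := by omega
          rw [this, hx]; linarith [hB i le_rfl]
      · intro i' hi'
        rcases Nat.lt_or_ge i' i with h | h
        · linarith [hC i' h]
        · have : i' = i := by omega
          rw [this]; linarith
      · intro i' hi' hcol
        rw [hs]
        refine hnew _ ?_
        rcases Nat.lt_or_ge i' i with h | h
        · have := hold _ (hD i' h (by linarith))
          exact_mod_cast (by linarith : (traj w i' 0 : ℤ) < (hgt (stateAt w i) : ℤ) + 1)
        · have : i' = i := by omega
          rw [this, hA]; linarith
    · -- east
      rw [h1] at hX hs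
      have hh := hgt_step_one hX
      rw [hdx] at hx; rw [hdy] at hy
      refine ⟨?_, ?_, ?_, ?_⟩
      · rw [hs, hh, hx, hA]; ring
      · intro i' hi'
        rcases Nat.lt_or_ge i' (i + 1) with h | h
        · exact hB i' (by omega)
        · have : i' = i + 1 := by omega
          rw [this, hx]; linarith [hB i le_rfl]
      · intro i' hi'
        rcases Nat.lt_or_ge i' i with h | h
        · linarith [hC i' h]
        · have : i' = i := by omega
          rw [this]; linarith
      · intro i' hi' hcol
        exfalso
        rcases Nat.lt_or_ge i' i with h | h
        · linarith [hC i' h]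
        · have : i' = i := by omega
          rw [this] at hcol; linarith
    · -- down
      rw [h2] at hX hs
      obtain ⟨hh, hold, hnew⟩ := step_two_spec hX
      rw [hdx] at hx; rw [hdy] at hy
      refine ⟨?_, ?_, ?_, ?_⟩
      · rw [hs, hx, hA]
        have : (hgt (stateAt w i) : ℤ) = hgt (step (stateAt w i) 2) + 1 := by exact_mod_cast hh.symm
        rw [this]; ring
      · intro i' hi'
        rcases Nat.lt_or_ge i' (i + 1) with h | h
        · exact hB i' (by omega)
        · have : i' = i + 1 := by omega
          rw [this, hx, hA]
          have : (1 : ℤ) ≤ hgt (stateAt w i) := by exact_mod_cast (show 1 ≤ hgt (stateAt w i) by omega)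
          linarith
      · intro i' hi'
        rcases Nat.lt_or_ge i' i with h | h
        · linarith [hC i' h]
        · have : i' = i := by omega
          rw [this]; linarith
      · intro i' hi' hcol
        rw [hs]
        refine hnew _ ?_
        have hcast : (hgt (step (stateAt w i) 2) : ℤ) + 1 = hgt (stateAt w i) := by exact_mod_cast hh
        rcases Nat.lt_or_ge i' i with h | h
        · have := hold _ (hD i' h (by linarith))
          linarith
        · have : i' = i := by omega
          rw [this, hA]; linarith
    · -- west: never
      rw [h3, step_three] at hX
      exact absurd rfl hX

/-- **Accepted words are half-plane self-avoiding walks**: the trajectory of an accepted word of length `n` lies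
in `hpWalks n`. [cite: BeatonGuttmannJensen2012Adsorption, §1 (p. 2)] -/
theorem traj_mem_hpWalks_of_accepted {n : ℕ} {w : List Step} (hl : w.length = n) (hacc : run W w ≠ X) :
    traj w ∈ hpWalks n := by
  classical
  have hinv := hook_invariant hacc
  have hsaw : IsSAW w := by
    rw [isSAW_iff_injOn]
    intro i hi j hj hij
    simp only [Set.mem_setOf_eq] at hi hj
    by_contra hne
    -- WLOG work with the later time: the earlier site differs from the current one
    have key : ∀ i j, i ≤ w.length → j ≤ w.length → i < j → traj w i ≠ traj w j := by
      intro i j hi hj hlt heq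
      obtain ⟨hA, -, hC, hD⟩ := hinv j hj
      have hcol : traj w i 1 = traj w j 1 := by rw [heq]
      have hrel := hD i hlt hcol
      have hx : traj w i 0 = traj w j 0 := by rw [heq]
      rw [hx, hA] at hrel
      have hjX : stateAt w j ≠ X := stateAt_ne_X hacc j
      revert hrel
      cases hst : stateAt w j with
      | W => simp [rel]
      | E => simp [rel, hgt]
      | U k => simp [rel, hgt]
      | A k => simp [rel]
      | D k => simp [rel, hgt]
      | X => exact absurd hst hjX
    rcases lt_or_gt_of_ne hne with h | h
    · exact key i j hi hj h hij
    · exact key j i hj hi h hij.symm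
  unfold hpWalks
  rw [Finset.mem_filter]
  refine ⟨traj_mem_saws hl hsaw, fun i hi => ?_⟩
  exact (hinv n (by omega)).2.1 i hi

/-- `landings` as a sum of indicators over the times `j+1`, `j < |w|`. [folklore] -/
private theorem landings_eq_sum (s : HookState) (v : List Step) :
    landings s v = ∑ j ∈ range v.length, if isWall (run s (v.take (j + 1))) then 1 else 0 := by
  induction v generalizing s with
  | nil => simp [landings]
  | cons st v ih =>
    rw [landings, List.length_cons, Finset.sum_range_succ', ih (step s st)]
    simp only [List.take_succ_cons, List.take_zero, run]
    omega

/-- **Wall visits are wall landings**: for an accepted word, `wallVisits n (traj w)` is the number of steps of the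
automaton that land in a wall state. [cite: BeatonGuttmannJensen2012Adsorption, §1 (p. 2)] -/
theorem wallVisits_traj_eq_landings {n : ℕ} {w : List Step} (hl : w.length = n) (hacc : run W w ≠ X) :
    wallVisits n (traj w) = landings W w := by
  classical
  have hinv := hook_invariant hacc
  unfold wallVisits
  rw [landings_eq_sum, hl, Finset.card_filter, Finset.sum_range_succ']
  have h0 : (if 1 ≤ 0 ∧ traj w 0 0 = 0 then 1 else 0) = 0 := if_neg (by omega)
  rw [h0, add_zero]
  refine Finset.sum_congr rfl fun j hj => ?_
  rw [Finset.mem_range] at hj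
  have hA := (hinv (j + 1) (by omega)).1
  have hiff : traj w (j + 1) 0 = 0 ↔ isWall (run W (w.take (j + 1))) := by
    rw [isWall_iff_hgt, hA]
    exact Nat.cast_eq_zero
  by_cases hz : traj w (j + 1) 0 = 0
  · rw [if_pos ⟨by omega, hz⟩, if_pos (hiff.1 hz)]
  · rw [if_neg (fun h => hz h.2), if_neg (fun h => hz (hiff.2 h))]

/-! ### The weighted count and the sub-eigenvector certificate -/

/-- Step weight at fugacity `a`: `a` for a wall landing, `1` otherwise, `0` into the dead state. [cite: BeatonGuttmannJensen2012Adsorption, §1 (p. 2)] -/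
def stepWt (a : ℝ) (t : HookState) : ℝ := if t = X then 0 else if isWall t then a else 1

/-- `N_n(s)`: the `a`-weighted number of accepted words of length `n` from state `s`. [cite: BeatonGuttmannJensen2012Adsorption, §1 (p. 2)] -/
def hookCount (a : ℝ) : ℕ → HookState → ℝ
  | 0, _ => 1
  | n + 1, s => ∑ st : Step, stepWt a (step s st) * hookCount a n (step s st)

/-- `N_n(s) ≥ 0`. [folklore] -/
private theorem hookCount_nonneg {a : ℝ} (ha : 0 ≤ a) : ∀ n s, 0 ≤ hookCount a n s
  | 0, s => by simp [hookCount]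
  | n + 1, s => by
    rw [hookCount]
    refine Finset.sum_nonneg fun st _ => mul_nonneg ?_ (hookCount_nonneg ha n _)
    unfold stepWt; split_ifs <;> linarith

/-- The certificate vector `u` (a rational approximation of the Perron eigenvector of the family's transfer matrix
at `a = 53/25`, normalised by `u(A₁) = 1`; zero on unreachable states). [cite: BeatonGuttmannJensen2012Adsorption, §1 (p. 2)] -/
def hookVec : HookState → ℝ
  | W => 838233 / 1000000
  | E => 659761 / 1000000
  | U 0 => 60089 / 125000
  | U 1 => 29479 / 100000
  | U 2 => 42147 / 250000
  | U 3 => 76541 / 1000000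
  | A 0 => 1
  | A 1 => 625423 / 1000000
  | A 2 => 377549 / 1000000
  | A 3 => 103081 / 500000
  | D 0 => 445277 / 500000
  | D 1 => 35177 / 62500
  | D 2 => 87283 / 250000
  | _ => 0

/-- `0 ≤ u ≤ 1`. [folklore] -/
private theorem hookVec_nonneg_le_one (s : HookState) : 0 ≤ hookVec s ∧ hookVec s ≤ 1 := by
  rcases s with _ | _ | k | k | k | _
  all_goals first
    | (rcases k with _ | _ | _ | _ | k <;> simp [hookVec] <;> norm_num)
    | (simp [hookVec]; try norm_num)

/-- **The sub-eigenvector certificate `M(53/25) · u ≥ (269/100) · u`** (13 rational inequalities, each strict by a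
margin `≥ 2·10⁻⁴`; the family's Perron root at `a = 2.12` is `2.69348…`). [cite: BeatonGuttmannJensen2012Adsorption, §1 (p. 2)] -/
theorem hook_certificate (s : HookState) :
    (269 / 100 : ℝ) * hookVec s ≤ ∑ st : Step, stepWt (53 / 25) (step s st) * hookVec (step s st) := by
  rcases s with _ | _ | k | k | k | _
  · simp [Fin.sum_univ_four, step, stepWt, isWall, hookVec]; norm_num
  · simp [step, stepWt, isWall, hookVec]; norm_num
  · rcases k with _ | _ | _ | _ | k <;> simp [Fin.sum_univ_four, step, stepWt, isWall, hookVec] <;> norm_num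
  · rcases k with _ | _ | _ | _ | k <;> simp [Fin.sum_univ_four, step, stepWt, isWall, hookVec] <;> norm_num
  · rcases k with _ | _ | _ | _ | k <;> simp [Fin.sum_univ_four, step, stepWt, isWall, hookVec] <;> norm_num
  · simp [step, stepWt, hookVec]

/-- **Exponential growth of the weighted count**: `N_n(s) ≥ (269/100)^n · u_s` at `a = 53/25`. [cite: BeatonGuttmannJensen2012Adsorption, §1 (p. 2)] -/
theorem pow_mul_hookVec_le_hookCount : ∀ (n : ℕ) (s : HookState),
    (269 / 100 : ℝ) ^ n * hookVec s ≤ hookCount (53 / 25) n s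
  | 0, s => by simpa [hookCount] using (hookVec_nonneg_le_one s).2
  | n + 1, s => by
    rw [hookCount]
    calc (269 / 100 : ℝ) ^ (n + 1) * hookVec s = (269 / 100) ^ n * ((269 / 100) * hookVec s) := by ring
      _ ≤ (269 / 100) ^ n * ∑ st : Step, stepWt (53 / 25) (step s st) * hookVec (step s st) :=
          mul_le_mul_of_nonneg_left (hook_certificate s) (by positivity)
      _ = ∑ st : Step, stepWt (53 / 25) (step s st) * ((269 / 100) ^ n * hookVec (step s st)) := by
          rw [Finset.mul_sum]; exact Finset.sum_congr rfl fun st _ => by ring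
      _ ≤ ∑ st : Step, stepWt (53 / 25) (step s st) * hookCount (53 / 25) n (step s st) := by
          refine Finset.sum_le_sum fun st _ => mul_le_mul_of_nonneg_left (pow_mul_hookVec_le_hookCount n _) ?_
          unfold stepWt; split_ifs <;> norm_num

/-! ### The weighted count is a sum over accepted words -/

/-- Words of length `n + 1` are `st :: w` with `w` of length `n`. [folklore] -/
private theorem words_succ (n : ℕ) :
    words (n + 1) = ((Finset.univ : Finset Step) ×ˢ words n).image fun p => p.1 :: p.2 := by
  ext w
  simp only [mem_words, Finset.mem_image, Finset.mem_product, Finset.mem_univ, true_and]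
  constructor
  · intro h
    cases w with
    | nil => simp at h
    | cons st w => exact ⟨(st, w), by simpa using h, rfl⟩
  · rintro ⟨⟨st, w'⟩, hw', rfl⟩
    simpa using hw'

/-- `N_n(s) = Σ_{w ∈ words n, accepted from s} a^{landings}` for a live state `s`. [cite: BeatonGuttmannJensen2012Adsorption, §1 (p. 2)] -/
theorem hookCount_eq_sum (a : ℝ) : ∀ (n : ℕ) {s : HookState}, s ≠ X →
    hookCount a n s = ∑ w ∈ words n, if run s w ≠ X then a ^ landings s w else 0
  | 0, s, hs => by
    have h0 : words 0 = {[]} := by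
      ext w; simp only [mem_words, Finset.mem_singleton, List.length_eq_zero_iff]
    rw [hookCount, h0, Finset.sum_singleton, run, if_pos hs, landings, pow_zero]
  | n + 1, s, hs => by
    classical
    rw [hookCount, words_succ, Finset.sum_image, Finset.sum_product]
    · refine Finset.sum_congr rfl fun st _ => ?_
      by_cases hX : step s st = X
      · simp only [run, hX, run_X, stepWt, if_true, zero_mul, ne_eq, not_true_eq_false, if_false,
          Finset.sum_const_zero]
      · rw [hookCount_eq_sum a n hX, Finset.mul_sum]
        refine Finset.sum_congr rfl fun w' _ => ?_
        simp only [run, landings]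
        by_cases hrun : run (step s st) w' ≠ X
        · rw [if_pos hrun, if_pos hrun, pow_add]
          unfold stepWt
          rw [if_neg hX]
          split_ifs <;> simp
        · rw [if_neg hrun, if_neg hrun, mul_zero]
    · rintro ⟨st, w⟩ _ ⟨st', w'⟩ _ h
      simp only [List.cons.injEq] at h
      exact Prod.ext h.1 h.2

/-! ### Assembly: `Z⁺_n(53/25) ≥ N_n(W) ≥ u_W · (269/100)^n` -/

/-- **`N_n(W) ≤ Z⁺_n(a)`** (`a ≥ 0`): the accepted words from `W` inject (via `traj`) into the half-plane walks, with
the right weights. [cite: BeatonGuttmannJensen2012Adsorption, §1 (p. 2)] -/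
theorem hookCount_le_adsZ (n : ℕ) {a : ℝ} (ha : 0 ≤ a) : hookCount a n W ≤ adsZ n a := by
  classical
  rw [hookCount_eq_sum a n (by simp), ← Finset.sum_filter]
  set acc := (words n).filter (fun w => run W w ≠ X) with hacc
  have hmem : ∀ w ∈ acc, w.length = n ∧ run W w ≠ X := fun w hw => by
    rw [hacc, Finset.mem_filter, mem_words] at hw; exact hw
  calc ∑ w ∈ acc, a ^ landings W w = ∑ w ∈ acc, a ^ wallVisits n (traj w) :=
        Finset.sum_congr rfl fun w hw => by rw [wallVisits_traj_eq_landings (hmem w hw).1 (hmem w hw).2]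
    _ = ∑ ω ∈ acc.image traj, a ^ wallVisits n ω := by
        rw [Finset.sum_image]
        intro w hw w' hw' h
        exact traj_injOn n (by simp [(hmem w hw).1]) (by simp [(hmem w' hw').1]) h
    _ ≤ ∑ ω ∈ hpWalks n, a ^ wallVisits n ω := by
        refine Finset.sum_le_sum_of_subset_of_nonneg ?_ fun ω _ _ => pow_nonneg ha _
        intro ω hω
        obtain ⟨w, hw, rfl⟩ := Finset.mem_image.1 hω
        exact traj_mem_hpWalks_of_accepted (hmem w hw).1 (hmem w hw).2
    _ = adsZ n a := rfl

/-- **`AdsorbedAbove (53/25) (269/100)`: `Z⁺_n(2.12) ≥ 0.838233 · 2.69ⁿ` for every `n`** — the adsorbed free energy at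
fugacity `a = 2.12` is at least `log 2.69 > log 2.688 ≥ log μ(ℤ²)`, so the Hammersley–Torrie–Whittington adsorption
point satisfies `a_c ≤ 2.12` (printed window: `1 < a_c ≤ μ`; numerics `a_c = 1.775`). The constant is
`K = u_W = 838233/10⁶`. [cite: BeatonGuttmannJensen2012Adsorption, §1 (p. 2)] -/
theorem adsorbedAbove_212 : AdsorbedAbove (53 / 25) (269 / 100) := by
  refine ⟨838233 / 1000000, by norm_num, fun n => ?_⟩
  have h1 := pow_mul_hookVec_le_hookCount n W
  have h2 := hookCount_le_adsZ n (a := 53 / 25) (by norm_num)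
  simp only [hookVec] at h1
  linarith

end Literature.Probability.RandomPlanarGeometry.SAW.Zd

end
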